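import Literature.NumberTheory.Transcendental.CalegariDimitrovTangL2Chi3ModSix
import Literature.NumberTheory.Transcendental.CalegariDimitrovTangL2Chi3Reduction
import Literature.Analysis.SpecialFunctions.TanhPartialFractions
import Mathlib.Tactic
import HarnessLib

/-!
# Calegari–Dimitrov–Tang, after Corollary 2: `ψ₁(n/6)` is irrational for every `n ≥ 1`

Sibling of `CalegariDimitrovTangL2Chi3.lean` (named fact
`Literature.NumberTheory.Transcendental.calegariDimitrovTang_linearIndependent`, CDT 2024
Thm. 1) and of `…ModSix.lean` (Cor. 2, lines 3–4). CDT, p. 3, after Corollary 2: "Note that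
since `ψ₁(x+1) − ψ₁(x) + 1/x² = 0`, it also follows from Theorem 1 (together with the fact that
`ψ₁(1) = π²/6` and `ψ₁(1/2) = π²/2`) that `ψ₁(n/6)` is irrational for any `n ∈ ℕ⁺`" — here
`ψ₁(z) = Σ_{k ≥ 0} 1/(z+k)² = ζ(2,z)` is the trigamma function, so that
`ψ₁(n/6) = 36 · Σ_{k ≥ 0} 1/(6k+n)²`.

This file proves that remark, phrased through the series `Σ_{k ≥ 0} 1/(6k+n)²` (Mathlib has no
polygamma function; the last statement rewrites it literally as `Σ_k 1/(k + n/6)²`):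

* the six residues: values `Σ 1/(6k+2)² = L(2,χ₋₃)/8 + π²/54`, `Σ 1/(6k+4)² = −L(2,χ₋₃)/8 + π²/54`
  (from the mod-`3` lines), `Σ 1/(6k+3)² = π²/72` (Euler's odd squares), `Σ 1/(6k+6)² = π²/216`
  (`ζ(2)/36`); irrationality of the residues `2, 4` from the fact, of `3, 6` **unconditionally**
  (`CalegariDimitrovTang.irrational_pi_sq`, Lindemann), of `1, 5` in `…ModSix.lean`;
* `calegariDimitrovTang_linearIndependent.irrational_tsum_one_div_six_mul_add_sq` — for every
  `n ≥ 1`, `Σ_{k ≥ 0} 1/(6k+n)²` is irrational (strong induction `n ↦ n + 6`: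
  `Σ_k 1/(6k+n+6)² = Σ_k 1/(6k+n)² − 1/n²`, i.e. `ψ₁(x+1) = ψ₁(x) − 1/x²`);
* `calegariDimitrovTang_linearIndependent.irrational_trigamma_div_six` — the same for
  `ψ₁(n/6) = Σ_{k ≥ 0} 1/(k + n/6)²` literally.

No named facts (D-0026); the values are unconditional theorems.

## References

* [CalegariDimitrovTang2024] arXiv:2408.15403, remark after Cor. 2 (p. 3).
-/

noncomputable section

open Filter Real

namespace Literature.NumberTheory.Transcendental

/-! ### The residues `2, 4, 3, 6 (mod 6)`: values -/

/-- `Σ_{k≥0} 1/(6k+2)² = ¼ Σ 1/(3k+1)² = L(2,χ₋₃)/8 + π²/54`. [cite: CalegariDimitrovTang2024, Cor. 2 (p. 3)] -/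
theorem tsum_one_div_six_mul_add_two_sq :
    ∑' k : ℕ, 1 / (6 * (k : ℝ) + 2) ^ 2 = L2chi3 / 8 + Real.pi ^ 2 / 54 := by
  have h : ∀ k : ℕ, 1 / (6 * (k : ℝ) + 2) ^ 2 = 1 / 4 * (1 / (3 * (k : ℝ) + 1) ^ 2) := by
    intro k
    rw [show (6 * (k : ℝ) + 2) ^ 2 = 4 * (3 * (k : ℝ) + 1) ^ 2 by ring, ← one_div_mul_one_div]
  simp_rw [h]
  rw [tsum_mul_left, tsum_one_div_three_mul_add_one_sq]
  ring

/-- `Σ_{k≥0} 1/(6k+4)² = ¼ Σ 1/(3k+2)² = −L(2,χ₋₃)/8 + π²/54`. [cite: CalegariDimitrovTang2024, Cor. 2 (p. 3)] -/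
theorem tsum_one_div_six_mul_add_four_sq :
    ∑' k : ℕ, 1 / (6 * (k : ℝ) + 4) ^ 2 = -(L2chi3 / 8) + Real.pi ^ 2 / 54 := by
  have h : ∀ k : ℕ, 1 / (6 * (k : ℝ) + 4) ^ 2 = 1 / 4 * (1 / (3 * (k : ℝ) + 2) ^ 2) := by
    intro k
    rw [show (6 * (k : ℝ) + 4) ^ 2 = 4 * (3 * (k : ℝ) + 2) ^ 2 by ring, ← one_div_mul_one_div]
  simp_rw [h]
  rw [tsum_mul_left, tsum_one_div_three_mul_add_two_sq]
  ring

/-- `Σ_{k≥0} 1/(6k+3)² = (1/9) Σ 1/(2k+1)² = π²/72` (`ψ₁(1/2) = π²/2`, Euler's odd squares).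
[cite: CalegariDimitrovTang2024, remark after Cor. 2 (p. 3)] -/
theorem tsum_one_div_six_mul_add_three_sq :
    ∑' k : ℕ, 1 / (6 * (k : ℝ) + 3) ^ 2 = Real.pi ^ 2 / 72 := by
  have h : ∀ k : ℕ, 1 / (6 * (k : ℝ) + 3) ^ 2 = 1 / 9 * (1 / (2 * (k : ℝ) + 1) ^ 2) := by
    intro k
    rw [show (6 * (k : ℝ) + 3) ^ 2 = 9 * (2 * (k : ℝ) + 1) ^ 2 by ring, ← one_div_mul_one_div]
  simp_rw [h]
  rw [tsum_mul_left, Literature.Analysis.SpecialFunctions.hasSum_one_div_odd_sq.tsum_eq]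
  ring

/-- `Σ_{k≥0} 1/(6k+6)² = (1/36) Σ_{k≥0} 1/(k+1)² = π²/216` (`ψ₁(1) = ζ(2) = π²/6`).
[cite: CalegariDimitrovTang2024, remark after Cor. 2 (p. 3)] -/
theorem tsum_one_div_six_mul_add_six_sq :
    ∑' k : ℕ, 1 / (6 * (k : ℝ) + 6) ^ 2 = Real.pi ^ 2 / 216 := by
  have hz : HasSum (fun k : ℕ => 1 / ((k : ℝ) + 1) ^ 2) (Real.pi ^ 2 / 6) := by
    have h := (hasSum_nat_add_iff (f := fun n : ℕ => 1 / (n : ℝ) ^ 2) 1).mpr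
      (by simpa using hasSum_zeta_two)
    refine h.congr_fun fun k => ?_
    push_cast
    rfl
  have h : ∀ k : ℕ, 1 / (6 * (k : ℝ) + 6) ^ 2 = 1 / 36 * (1 / ((k : ℝ) + 1) ^ 2) := by
    intro k
    rw [show (6 * (k : ℝ) + 6) ^ 2 = 36 * ((k : ℝ) + 1) ^ 2 by ring, ← one_div_mul_one_div]
  simp_rw [h]
  rw [tsum_mul_left, hz.tsum_eq]
  ring

/-! ### The residues `2, 4, 3, 6 (mod 6)`: irrationality -/

/-- `Σ 1/(6k+2)²` is irrational (from Theorem 1; coefficient `1/8` of `L(2,χ₋₃)`).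
[cite: CalegariDimitrovTang2024, remark after Cor. 2 (p. 3)] -/
theorem calegariDimitrovTang_linearIndependent.irrational_tsum_one_div_six_mul_add_two_sq
    (h : calegariDimitrovTang_linearIndependent) :
    Irrational (∑' k : ℕ, 1 / (6 * (k : ℝ) + 2) ^ 2) := by
  rw [tsum_one_div_six_mul_add_two_sq]
  rintro ⟨q, hq⟩
  have := (h.eq_zero q (-(1 / 54)) (-(1 / 8)) (by push_cast; linarith)).2.2
  norm_num at this

/-- `Σ 1/(6k+4)²` is irrational (from Theorem 1). [cite: CalegariDimitrovTang2024, remark after Cor. 2 (p. 3)] -/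
theorem calegariDimitrovTang_linearIndependent.irrational_tsum_one_div_six_mul_add_four_sq
    (h : calegariDimitrovTang_linearIndependent) :
    Irrational (∑' k : ℕ, 1 / (6 * (k : ℝ) + 4) ^ 2) := by
  rw [tsum_one_div_six_mul_add_four_sq]
  rintro ⟨q, hq⟩
  have := (h.eq_zero q (-(1 / 54)) (1 / 8) (by push_cast; linarith)).2.2
  norm_num at this

/-- `Σ 1/(6k+3)² = π²/72` is irrational — **unconditionally** (Lindemann, via
`CalegariDimitrovTang.irrational_pi_sq`). [cite: CalegariDimitrovTang2024, remark after Cor. 2 (p. 3)] -/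
theorem irrational_tsum_one_div_six_mul_add_three_sq :
    Irrational (∑' k : ℕ, 1 / (6 * (k : ℝ) + 3) ^ 2) := by
  rw [tsum_one_div_six_mul_add_three_sq]
  simpa using CalegariDimitrovTang.irrational_pi_sq.div_natCast (m := 72) (by norm_num)

/-- `Σ 1/(6k+6)² = π²/216` is irrational — **unconditionally**.
[cite: CalegariDimitrovTang2024, remark after Cor. 2 (p. 3)] -/
theorem irrational_tsum_one_div_six_mul_add_six_sq :
    Irrational (∑' k : ℕ, 1 / (6 * (k : ℝ) + 6) ^ 2) := by
  rw [tsum_one_div_six_mul_add_six_sq]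
  simpa using CalegariDimitrovTang.irrational_pi_sq.div_natCast (m := 216) (by norm_num)

/-! ### All `n ≥ 1`: `ψ₁(n/6)/36 = Σ_{k≥0} 1/(6k+n)²` is irrational -/

/-- **The functional equation `ψ₁(x+1) = ψ₁(x) − 1/x²`, series form**:
`Σ_{k≥0} 1/(6k+n+6)² = Σ_{k≥0} 1/(6k+n)² − 1/n²`. [cite: CalegariDimitrovTang2024, remark after Cor. 2 (p. 3)] -/
theorem tsum_one_div_six_mul_add_add_six_sq (n : ℕ) :
    ∑' k : ℕ, 1 / (6 * (k : ℝ) + ((n + 6 : ℕ) : ℝ)) ^ 2 =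
      (∑' k : ℕ, 1 / (6 * (k : ℝ) + n) ^ 2) - 1 / (n : ℝ) ^ 2 := by
  have hs := summable_one_div_six_mul_add_sq n
  rw [hs.tsum_eq_zero_add]
  have e : (fun k : ℕ => 1 / (6 * (k : ℝ) + ((n + 6 : ℕ) : ℝ)) ^ 2)
      = fun k : ℕ => 1 / (6 * ((k + 1 : ℕ) : ℝ) + n) ^ 2 := by
    funext k
    push_cast
    ring
  rw [e]
  push_cast
  ring

/-- **CDT, remark after Corollary 2: `ψ₁(n/6)` is irrational for every `n ∈ ℕ⁺`**, in the form:
`Σ_{k ≥ 0} 1/(6k+n)²` (`= ψ₁(n/6)/36`) is irrational for every `n ≥ 1`. From Theorem 1 through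
the six residues (`…ModSix.lean` for `±1`, the four theorems above) and the shift `n ↦ n + 6`.
[cite: CalegariDimitrovTang2024, remark after Cor. 2 (p. 3)] -/
theorem calegariDimitrovTang_linearIndependent.irrational_tsum_one_div_six_mul_add_sq
    (h : calegariDimitrovTang_linearIndependent) {n : ℕ} (hn : n ≠ 0) :
    Irrational (∑' k : ℕ, 1 / (6 * (k : ℝ) + n) ^ 2) := by
  induction n using Nat.strong_induction_on with
  | _ n ih =>
    by_cases h6 : n ≤ 6
    · interval_cases n
      · exact absurd rfl hn
      · simpa using h.irrational_tsum_one_div_six_mul_add_one_sq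
      · simpa using h.irrational_tsum_one_div_six_mul_add_two_sq
      · simpa using irrational_tsum_one_div_six_mul_add_three_sq
      · simpa using h.irrational_tsum_one_div_six_mul_add_four_sq
      · simpa using h.irrational_tsum_one_div_six_mul_add_five_sq
      · simpa using irrational_tsum_one_div_six_mul_add_six_sq
    · obtain ⟨m, rfl⟩ : ∃ m, n = m + 6 := ⟨n - 6, by omega⟩
      have hm : m ≠ 0 := by omega
      rw [tsum_one_div_six_mul_add_add_six_sq m]
      have hq : (1 / (m : ℝ) ^ 2) = ((1 / (m : ℚ) ^ 2 : ℚ) : ℝ) := by push_cast; ring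
      rw [hq]
      exact Irrational.sub_ratCast _ (ih m (by omega) hm)

/-- **`ψ₁(n/6)` is irrational for every `n ∈ ℕ⁺`**, literally for the trigamma series
`ψ₁(n/6) = Σ_{k ≥ 0} 1/(k + n/6)²` (`= 36 Σ_k 1/(6k+n)²`).
[cite: CalegariDimitrovTang2024, remark after Cor. 2 (p. 3)] -/
theorem calegariDimitrovTang_linearIndependent.irrational_trigamma_div_six
    (h : calegariDimitrovTang_linearIndependent) {n : ℕ} (hn : n ≠ 0) :
    Irrational (∑' k : ℕ, 1 / ((k : ℝ) + n / 6) ^ 2) := by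
  have e : ∀ k : ℕ, 1 / ((k : ℝ) + n / 6) ^ 2 = ((36 : ℚ) : ℝ) * (1 / (6 * (k : ℝ) + n) ^ 2) := by
    intro k
    rw [show ((k : ℝ) + n / 6) ^ 2 = (6 * (k : ℝ) + n) ^ 2 / 36 by ring]
    push_cast
    rw [one_div_div, div_eq_mul_one_div]
  simp_rw [e]
  rw [tsum_mul_left]
  exact Irrational.ratCast_mul (h.irrational_tsum_one_div_six_mul_add_sq hn) (by norm_num)

end Literature.NumberTheory.Transcendental
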